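import Literature.Analysis.FluidPDE.TaoEnstrophyExteriorLeaves
import Literature.Analysis.FluidPDE.TaoBoundedTotalSpeedProofs
import HarnessLib

/-!
# Tao (2011/2013), Thm. 10.1 in the exterior form of Remark 10.6 from the single remaining
# named fact, the §10 nonlinear estimate for `Y₆`

`Literature.Analysis.FluidPDE.tao2011_enstrophyLocalisation_exterior` (`TaoEnstrophyLocalisation.lean`;
Tao 2011, arXiv:1108.1165, Thm. 10.1 = arXiv Thm. 59 with Remark 10.6 = arXiv Rem. 64, every
viscosity `ν > 0`, `f = 0`) was reduced in `TaoEnstrophyExteriorLeaves.lean` to the two analytic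
leaves of the printed proof, the §10 estimate for the nonlinear term `Y₆`
(`tao2011_nonlinearEstimate`) and the §9 total speed of the nonlinear Duhamel component
(`tao2011_duhamelNonlinearSpeed_unit`). The second is now a theorem of the tree
(`tao2011_duhamelNonlinearSpeed_unit_holds`, whence Prop. 9.1 for every `ν > 0`,
`tao2011_boundedTotalSpeed_holds`, `TaoBoundedTotalSpeedProofs.lean`), so Thm. 10.1 (exterior
form) rests on the `Y₆` estimate alone:

* `tao2011_enstrophyLocalisation_exterior_of_nonlinearEstimate :
    tao2011_nonlinearEstimate → tao2011_enstrophyLocalisation_exterior`.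

Discharging `tao2011_nonlinearEstimate` turns this into `tao2011_enstrophyLocalisation_exterior_holds`.
Kept in its own file so that `TaoEnstrophyExteriorLeaves.lean` (which states the two-leaf form with
Prop. 9.1 as a hypothesis) does not import the discharge of Prop. 9.1. No statement is modified and
no definition is introduced.

## Mathlib / tree search

`lean search 'enstrophyLocalisation_exterior_of_nonlinearEstimate' --decl`: only the two-leaf form
`…_of_nonlinearEstimate_of_duhamel` (`TaoEnstrophyExteriorLeaves`). Reused, not restated:
`tao2011_enstrophyLocalisation_exterior_of_parts`, `tao_finite_energy_smooth_energy_bound_holds`,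
`tao2011_boundedTotalSpeed_holds`, `tao2011_enstrophyLocalisation_exterior_apriori_of_nonlinearEstimate`.

## References

* T. Tao, *Localisation and compactness properties of the Navier–Stokes global regularity
  problem*, Anal. PDE 6 (2013) 25–107 = arXiv:1108.1165 (`Tao2011`): Thm. 10.1 and its proof
  (arXiv Thm. 59, §10, pp. 30–33), Remark 10.6 (arXiv Rem. 64, p. 33), Prop. 9.1 (arXiv Prop. 52),
  Lemma 8.1 (arXiv Lemma 44).
-/

noncomputable section

namespace Literature.Analysis.FluidPDE

/-- **Tao 2011, Thm. 10.1 in the exterior form of Remark 10.6, from the single remaining leaf**: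
with Prop. 9.1 discharged for every `ν > 0` (`tao2011_boundedTotalSpeed_holds`) and Lemma 8.1
discharged (`tao_finite_energy_smooth_energy_bound_holds`), `tao2011_enstrophyLocalisation_exterior_of_parts`
reduces the theorem to the §10 nonlinear estimate `tao2011_nonlinearEstimate`
(`tao2011_enstrophyLocalisation_exterior_apriori_of_nonlinearEstimate`). [cite: Tao2011, Thm. 10.1 + Remark 10.6] -/
theorem tao2011_enstrophyLocalisation_exterior_of_nonlinearEstimate
    (hY : tao2011_nonlinearEstimate) : tao2011_enstrophyLocalisation_exterior :=
  tao2011_enstrophyLocalisation_exterior_of_parts tao_finite_energy_smooth_energy_bound_holds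
    tao2011_boundedTotalSpeed_holds
    (tao2011_enstrophyLocalisation_exterior_apriori_of_nonlinearEstimate hY)

end Literature.Analysis.FluidPDE

end
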